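import Mathlib.MeasureTheory.Measure.Prokhorov
import Mathlib.MeasureTheory.Measure.LevyProkhorovMetric
import Mathlib.MeasureTheory.Measure.Regular
import Literature.Analysis.FluidPDE.ReynoldsDefectMeasure
import HarnessLib

/-!
# Weak-\* compactness tools for Reynolds defect measures

Measure-theoretic lemmas behind the existence of Reynolds (weak-\*) defect measures
(DiPerna–Majda 1987, Thm. 1; Majda–Bertozzi 2002, §11.1), proved in full from Mathlib:

* `exists_subseq_tendsto_finiteMeasure_of_mass_le`: on a compact metrizable space, a sequence of
  finite Borel measures with bounded mass has a weakly convergent subsequence (Prokhorov /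
  Banach–Alaoglu on `C(Ω)^*`; here via Mathlib's compactness of `ProbabilityMeasure Ω`, its
  Lévy–Prokhorov metrizability, and normalization `μ = mass μ • normalize μ`);
  `exists_subseq_forall_tendsto_finiteMeasure_of_mass_le`: a common subsequence for finitely many
  such sequences (diagonal extraction);
* `measure_isClosed_le_of_forall_lintegral_le`, `signedMeasure_nonneg_of_forall_integral_nonneg`:
  a finite signed Borel measure on a metrizable space which is nonnegative on nonnegative bounded
  continuous functions is nonnegative on every set (Jordan decomposition, approximation of closed
  sets by continuous functions, inner regularity);
* `exists_finiteMeasure_integral_eq_mul`: a nonnegative integrable density `g` on a finite measure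
  space defines a finite measure `g dμ` with `∫ f d(g μ) = ∫ f g dμ` and mass `∫ g`.

No new definitions. These are the ingredients of
`Literature.Analysis.FluidPDE.Torus.exists_isReynoldsDefectOf_subseq_holds`
(`ReynoldsDefectMeasureExistence.lean`).

## References

* R. J. DiPerna, A. J. Majda, Comm. Math. Phys. 108 (1987), §1, Thm. 1.
* A. J. Majda, A. L. Bertozzi, *Vorticity and Incompressible Flow*, CUP 2002, Lemma 10.1, §11.1.
-/

open MeasureTheory Filter Set
open _root_.Topology _root_.TopologicalSpace
open scoped ENNReal NNReal BoundedContinuousFunction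

noncomputable section

namespace Literature.Analysis.FluidPDE

/-! ## Sequential weak-\* compactness of bounded sets of finite measures -/

section Extraction

variable {Ω : Type*} [MeasurableSpace Ω] [TopologicalSpace Ω] [CompactSpace Ω] [T2Space Ω]
  [BorelSpace Ω] [PseudoMetrizableSpace Ω] [SeparableSpace Ω] [Nonempty Ω]

/-- **Bounded sequences of finite measures on a compact metrizable space have weakly convergent
subsequences** (`M(Ω) = C(Ω)^*`, Banach–Alaoglu plus separability; Majda–Bertozzi 2002,
Lemma 10.1). Proof: extract a subsequence along which the normalized probability measures
converge (the space of probability measures of a compact space is compact and, by the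
Lévy–Prokhorov metric, metrizable) and the masses converge; the limit is `m • P`. [folklore] -/
theorem exists_subseq_tendsto_finiteMeasure_of_mass_le (μs : ℕ → FiniteMeasure Ω) {M : ℝ≥0}
    (hM : ∀ n, (μs n).mass ≤ M) :
    ∃ ψ : ℕ → ℕ, StrictMono ψ ∧ ∃ μ : FiniteMeasure Ω,
      Tendsto (fun n => μs (ψ n)) atTop (𝓝 μ) := by
  set x : ℕ → ProbabilityMeasure Ω × ℝ≥0 := fun n => ((μs n).normalize, (μs n).mass) with hx
  have hK : IsCompact ((univ : Set (ProbabilityMeasure Ω)) ×ˢ Icc (0 : ℝ≥0) M) :=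
    isCompact_univ.prod isCompact_Icc
  obtain ⟨⟨P, m⟩, -, ψ, hψ, hlim⟩ :=
    hK.tendsto_subseq (x := x) fun n => ⟨mem_univ _, zero_le, hM n⟩
  refine ⟨ψ, hψ, m • P.toFiniteMeasure, ?_⟩
  have hP : Tendsto (fun n => (μs (ψ n)).normalize) atTop (𝓝 P) :=
    (continuous_fst.tendsto (P, m)).comp hlim
  have hm : Tendsto (fun n => (μs (ψ n)).mass) atTop (𝓝 m) :=
    (continuous_snd.tendsto (P, m)).comp hlim
  rw [FiniteMeasure.tendsto_iff_forall_testAgainstNN_tendsto]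
  intro f
  have hP' := (ProbabilityMeasure.tendsto_nhds_iff_toFiniteMeasure_tendsto_nhds _).1 hP
  rw [FiniteMeasure.tendsto_iff_forall_testAgainstNN_tendsto] at hP'
  have h2 := hm.mul (hP' f)
  simp only [Function.comp_apply] at h2
  rw [FiniteMeasure.smul_testAgainstNN_apply, smul_eq_mul]
  refine h2.congr fun n => ?_
  exact ((μs (ψ n)).testAgainstNN_eq_mass_mul f).symm

/-- **Diagonal extraction**: finitely many sequences of finite measures with uniformly bounded
mass on a compact metrizable space have a common weakly convergent subsequence. [folklore] -/
theorem exists_subseq_forall_tendsto_finiteMeasure_of_mass_le {κ : Type*} [Finite κ]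
    (μs : κ → ℕ → FiniteMeasure Ω) {M : ℝ≥0} (hM : ∀ k n, (μs k n).mass ≤ M) :
    ∃ ψ : ℕ → ℕ, StrictMono ψ ∧ ∀ k, ∃ μ : FiniteMeasure Ω,
      Tendsto (fun n => μs k (ψ n)) atTop (𝓝 μ) := by
  classical
  haveI := Fintype.ofFinite κ
  suffices h : ∀ S : Finset κ, ∃ ψ : ℕ → ℕ, StrictMono ψ ∧ ∀ k ∈ S, ∃ μ : FiniteMeasure Ω,
      Tendsto (fun n => μs k (ψ n)) atTop (𝓝 μ) by
    obtain ⟨ψ, hψ, h⟩ := h Finset.univ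
    exact ⟨ψ, hψ, fun k => h k (Finset.mem_univ k)⟩
  intro S
  induction S using Finset.induction_on with
  | empty => exact ⟨id, strictMono_id, fun k hk => absurd hk (Finset.notMem_empty k)⟩
  | @insert k₀ S _ ih =>
    obtain ⟨ψ, hψ, hS⟩ := ih
    obtain ⟨ψ', hψ', μ₀, hμ₀⟩ :=
      exists_subseq_tendsto_finiteMeasure_of_mass_le (fun n => μs k₀ (ψ n)) fun n => hM k₀ (ψ n)
    refine ⟨ψ ∘ ψ', hψ.comp hψ', fun k hk => ?_⟩
    rcases Finset.mem_insert.1 hk with rfl | hk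
    · exact ⟨μ₀, hμ₀⟩
    · obtain ⟨μ, hμ⟩ := hS k hk
      exact ⟨μ, hμ.comp hψ'.tendsto_atTop⟩

end Extraction

/-! ## Nonnegativity of a signed measure from its action on continuous functions -/

section Nonneg

variable {Ω : Type*} [MeasurableSpace Ω] [TopologicalSpace Ω]

/-- If `∫ f dμ ≤ ∫ f dν` for all bounded continuous `f ≥ 0`, then `μ F ≤ ν F` for every closed
set `F` (finite measures, `HasOuterApproxClosed`): pass to the limit along an approximating
sequence of the indicator of `F`. [folklore] -/
theorem measure_isClosed_le_of_forall_lintegral_le [HasOuterApproxClosed Ω]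
    [OpensMeasurableSpace Ω] {μ ν : Measure Ω} [IsFiniteMeasure μ] [IsFiniteMeasure ν]
    (h : ∀ f : Ω →ᵇ ℝ≥0, ∫⁻ x, f x ∂μ ≤ ∫⁻ x, f x ∂ν) {F : Set Ω} (hF : IsClosed F) :
    μ F ≤ ν F :=
  le_of_tendsto_of_tendsto (HasOuterApproxClosed.tendsto_lintegral_apprSeq hF μ)
    (HasOuterApproxClosed.tendsto_lintegral_apprSeq hF ν) (Eventually.of_forall fun _ => h _)

/-- Bounded continuous functions are integrable against (the variation of) the signed measure of
a finite measure. [folklore] -/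
theorem integrable_toSignedMeasure_boundedContinuous [OpensMeasurableSpace Ω] (μ : Measure Ω)
    [IsFiniteMeasure μ] (f : Ω →ᵇ ℝ) : μ.toSignedMeasure.Integrable f := by
  show Integrable (⇑f) μ.toSignedMeasure.variation
  rw [Measure.variation_toSignedMeasure]
  exact BoundedContinuousFunction.integrable μ f

/-- **A finite signed Borel measure on a metrizable space which is nonnegative on nonnegative
bounded continuous functions is nonnegative.** Proof: write `s = s⁺ - s⁻` (Jordan), so
`∫ f ds⁻ ≤ ∫ f ds⁺` for `f ≥ 0`; hence `s⁻ F ≤ s⁺ F` for closed `F`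
(`measure_isClosed_le_of_forall_lintegral_le`); `s⁺` vanishes on a measurable set `S` carrying
`s⁻`, so `s⁻ K = 0` for every closed `K ⊆ S`, whence `s⁻ S = 0` by inner regularity, `s⁻ = 0`
and `s = s⁺ ≥ 0`. [folklore] -/
theorem signedMeasure_nonneg_of_forall_integral_nonneg [PseudoMetrizableSpace Ω] [BorelSpace Ω]
    {s : SignedMeasure Ω} (h : ∀ f : Ω →ᵇ ℝ, (∀ x, 0 ≤ f x) → 0 ≤ ∫ᵛ x, f x ∂<•s)
    (A : Set Ω) : 0 ≤ s A := by
  by_cases hA : MeasurableSet A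
  swap
  · rw [s.not_measurable hA]
  set j := s.toJordanDecomposition with hj
  have hs : s = j.posPart.toSignedMeasure - j.negPart.toSignedMeasure :=
    (SignedMeasure.toSignedMeasure_toJordanDecomposition s).symm
  -- Step 1: `∫ f ds⁻ ≤ ∫ f ds⁺` for nonnegative bounded continuous `f`
  have h1 : ∀ f : Ω →ᵇ ℝ≥0, ∫⁻ x, f x ∂j.negPart ≤ ∫⁻ x, f x ∂j.posPart := by
    intro f
    set g : Ω →ᵇ ℝ := ⟨⟨fun x => (f x : ℝ), NNReal.continuous_coe.comp f.continuous⟩, f.map_bounded'⟩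
      with hg
    have hg0 := h g fun x => (f x).coe_nonneg
    rw [hs, VectorMeasure.integral_sub_vectorMeasure
      (integrable_toSignedMeasure_boundedContinuous _ g)
      (integrable_toSignedMeasure_boundedContinuous _ g),
      VectorMeasure.integral_toSignedMeasure, VectorMeasure.integral_toSignedMeasure] at hg0
    have e1 : ∫ x, g x ∂j.posPart = (∫⁻ x, (f x : ℝ≥0∞) ∂j.posPart).toReal :=
      (BoundedContinuousFunction.toReal_lintegral_coe_eq_integral f _).symm
    have e2 : ∫ x, g x ∂j.negPart = (∫⁻ x, (f x : ℝ≥0∞) ∂j.negPart).toReal :=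
      (BoundedContinuousFunction.toReal_lintegral_coe_eq_integral f _).symm
    rw [e1, e2, sub_nonneg] at hg0
    exact (ENNReal.toReal_le_toReal (BoundedContinuousFunction.lintegral_lt_top_of_nnreal _ f).ne
      (BoundedContinuousFunction.lintegral_lt_top_of_nnreal _ f).ne).1 hg0
  -- Step 2: closed sets
  have h2 : ∀ F : Set Ω, IsClosed F → j.negPart F ≤ j.posPart F := fun F hF =>
    measure_isClosed_le_of_forall_lintegral_le h1 hF
  -- Step 3: `s⁻ = 0`
  obtain ⟨S, hSm, hpos, hneg⟩ := j.mutuallySingular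
  have h3 : j.negPart S = 0 := by
    by_contra hne
    obtain ⟨K, hKS, hK, hK0⟩ :=
      hSm.exists_lt_isClosed_of_ne_top (measure_ne_top _ _) (pos_iff_ne_zero.2 hne)
    have hle : j.negPart K ≤ 0 :=
      (h2 K hK).trans ((measure_mono hKS).trans_eq hpos)
    exact absurd (hK0.trans_le hle) (lt_irrefl 0)
  have h4 : j.negPart = 0 := by
    rw [← Measure.measure_univ_eq_zero, ← Set.union_compl_self S]
    exact le_antisymm ((measure_union_le _ _).trans (by rw [h3, hneg, add_zero])) zero_le
  -- conclusion
  have h5 : j.negPart.real A = 0 := by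
    simp [measureReal_def, h4]
  rw [hs, Measure.toSignedMeasure_sub_apply hA, h5, sub_zero]
  exact measureReal_nonneg

end Nonneg

/-! ## Finite measures with a nonnegative integrable density -/

section Density

variable {Ω : Type*} [MeasurableSpace Ω] [TopologicalSpace Ω]

/-- **The finite measure `g dμ` of a nonnegative integrable density.** If `0 ≤ g ∈ L¹(μ)` with
`∫ g dμ ≤ M`, there is a finite measure `ν` (namely `g μ`) of mass at most `M` with
`∫ f dν = ∫ f g dμ` for every bounded continuous `f`. [folklore] -/
theorem exists_finiteMeasure_integral_eq_mul (μ : Measure Ω) {g : Ω → ℝ} (hg : Integrable g μ)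
    (hg0 : ∀ x, 0 ≤ g x) {M : ℝ} (hM : ∫ x, g x ∂μ ≤ M) :
    ∃ ν : FiniteMeasure Ω, ν.mass ≤ M.toNNReal ∧
      ∀ f : Ω →ᵇ ℝ, ∫ x, f x ∂(ν : Measure Ω) = ∫ x, f x * g x ∂μ := by
  haveI : IsFiniteMeasure (μ.withDensity fun x => ENNReal.ofReal (g x)) :=
    isFiniteMeasure_withDensity_ofReal hg.2
  refine ⟨⟨μ.withDensity fun x => ENNReal.ofReal (g x), inferInstance⟩, ?_, fun f => ?_⟩
  · have h1 : (μ.withDensity fun x => ENNReal.ofReal (g x)) univ = ENNReal.ofReal (∫ x, g x ∂μ) := by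
      rw [withDensity_apply _ MeasurableSet.univ, Measure.restrict_univ,
        ofReal_integral_eq_lintegral_ofReal hg (ae_of_all _ hg0)]
    have h2 : ((FiniteMeasure.mass ⟨μ.withDensity fun x => ENNReal.ofReal (g x), inferInstance⟩
        : ℝ≥0) : ℝ≥0∞) ≤ ((M.toNNReal : ℝ≥0) : ℝ≥0∞) := by
      rw [FiniteMeasure.ennreal_mass]
      show (μ.withDensity fun x => ENNReal.ofReal (g x)) univ ≤ ENNReal.ofReal M
      rw [h1]
      exact ENNReal.ofReal_le_ofReal hM
    exact_mod_cast h2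
  · show ∫ x, f x ∂(μ.withDensity fun x => ENNReal.ofReal (g x)) = _
    rw [integral_withDensity_eq_integral_toReal_smul₀ hg.1.aemeasurable.ennreal_ofReal
      (ae_of_all _ fun _ => ENNReal.ofReal_lt_top)]
    refine integral_congr_ae (ae_of_all _ fun x => ?_)
    show (ENNReal.ofReal (g x)).toReal • f x = f x * g x
    rw [ENNReal.toReal_ofReal (hg0 x), smul_eq_mul, mul_comm]

end Density

end Literature.Analysis.FluidPDE

end
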